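import Mathlib

/-!
# Divergence-free pull-back under the corner blow-up chart (generic in the dimension)

Generic calculus for the Liouville rotation flow (crux `MultiplicationAccessible`, line
`shifted-family-prime-sieve`, design `GeneralPDesign.md`): if `Y` is a vector field on the cube
`(0,1)^(m+1)` with `div Y = 0` and `T(θ, y) = (1 − y θ₀, 1 − y θ₁, …, 1 − y θ_m)` (`θ₀ = 1 − Σθ_i`) is the
corner blow-up chart, then the field `Ỹ_y = y^m Σ_k Y_k∘T`, `Ỹ_{θ_i} = y^(m−1)(Y_{i+1}∘T − θ_i Σ_k Y_k∘T)`
(the adjugate pull-back, up to a constant sign) is divergence free. Here: the pointwise ALGEBRAIC core,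
with the chain-rule values of the partial derivatives as data.
-/

open Finset
open scoped BigOperators

namespace Summit.KontsevichZagierPeriods.TerasomaMultiplication.MultiplicationAccessible

namespace DivPullback

/-- **Piola algebra for the blow-up chart.** With `dθZ k i = y·D0 k − y·Dm k i` (the `θ_i`-derivative of
`Y_k∘T`) and `dyZ k = −(θ₀·D0 k + Σ_i θ_i·Dm k i)` (its `y`-derivative), the signed sum of the derivatives
of the adjugate components vanishes as soon as `div Y = D0 0 + Σ_i Dm (i+1) i = 0`. [folklore] -/
theorem piola_alg (n : ℕ) (θ : Fin (n + 1) → ℝ) (y : ℝ) (Z D0 : Fin (n + 2) → ℝ)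
    (Dm : Fin (n + 2) → Fin (n + 1) → ℝ) (hdiv : D0 0 + ∑ i, Dm i.succ i = 0) :
    (∑ i : Fin (n + 1), y ^ n * ((y * D0 i.succ - y * Dm i.succ i) - (∑ k, Z k) -
        θ i * ∑ k, (y * D0 k - y * Dm k i))) +
      ((n + 1) * y ^ n * (∑ k, Z k) +
        y ^ (n + 1) * ∑ k, (-((1 - ∑ i, θ i) * D0 k + ∑ i, θ i * Dm k i))) = 0 := by
  -- abbreviations for the elementary sums
  set A := ∑ i : Fin (n + 1), D0 i.succ with hA
  set B := ∑ i : Fin (n + 1), Dm i.succ i with hB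
  set G := ∑ k, Z k with hG
  set E := ∑ k, D0 k with hE
  set Sθ := ∑ i, θ i with hSθ
  set C : Fin (n + 1) → ℝ := fun i => ∑ k, Dm k i with hC
  set F := ∑ i, θ i * C i with hF
  have hin : ∀ i, ∑ k, (y * D0 k - y * Dm k i) = y * E - y * C i := by
    intro i
    rw [Finset.sum_sub_distrib, ← Finset.mul_sum, ← Finset.mul_sum]
  have hE' : E = D0 0 + A := by
    rw [hE, Fin.sum_univ_succ]
  -- first block
  have h1 : ∑ i : Fin (n + 1), y ^ n * ((y * D0 i.succ - y * Dm i.succ i) - G -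
      θ i * ∑ k, (y * D0 k - y * Dm k i)) =
      y ^ (n + 1) * A - y ^ (n + 1) * B - (n + 1) * (y ^ n * G) - y ^ (n + 1) * E * Sθ + y ^ (n + 1) * F := by
    have : ∀ i ∈ (Finset.univ : Finset (Fin (n + 1))), y ^ n * ((y * D0 i.succ - y * Dm i.succ i) - G -
        θ i * ∑ k, (y * D0 k - y * Dm k i)) =
        y ^ (n + 1) * D0 i.succ - y ^ (n + 1) * Dm i.succ i - y ^ n * G - (y ^ (n + 1) * E) * θ i +
          y ^ (n + 1) * (θ i * C i) := by
      intro i _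
      rw [hin i]
      ring
    rw [Finset.sum_congr rfl this]
    simp only [Finset.sum_add_distrib, Finset.sum_sub_distrib, ← Finset.mul_sum, Finset.sum_const,
      Finset.card_univ, Fintype.card_fin, nsmul_eq_mul]
    push_cast
    ring
  -- second block
  have h2 : ∑ k, (-((1 - Sθ) * D0 k + ∑ i, θ i * Dm k i)) = -((1 - Sθ) * E) - F := by
    have hcomm : ∑ k : Fin (n + 2), ∑ i : Fin (n + 1), θ i * Dm k i = F := by
      rw [hF, Finset.sum_comm]
      refine Finset.sum_congr rfl fun i _ => ?_
      rw [hC, Finset.mul_sum]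
    rw [Finset.sum_neg_distrib, Finset.sum_add_distrib, ← Finset.mul_sum, hcomm, ← hE]
    ring
  rw [h1, h2, hE']
  have hdiv' : D0 0 + B = 0 := hdiv
  linear_combination (-(y ^ (n + 1))) * hdiv'

/-- Product rule for the `θ_i`-slice of the adjugate component `Ỹ_{θ_i} = y^n (Z_{i+1} − θ_i Σ_k Z_k)`.
[folklore] -/
theorem hasDerivAt_adjTheta {n : ℕ} (u : Fin (n + 2) → ℝ) (Zf : Fin (n + 2) → (Fin (n + 2) → ℝ) → ℝ)
    (i : Fin (n + 1)) (dZ : Fin (n + 2) → ℝ)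
    (hZ : ∀ k, HasDerivAt (fun a => Zf k (Function.update u i.castSucc a)) (dZ k) (u i.castSucc)) :
    HasDerivAt (fun a => (Function.update u i.castSucc a (Fin.last (n + 1))) ^ n *
        (Zf i.succ (Function.update u i.castSucc a) -
          (Function.update u i.castSucc a i.castSucc) * ∑ k, Zf k (Function.update u i.castSucc a)))
      ((u (Fin.last (n + 1))) ^ n * (dZ i.succ - (1 * ∑ k, Zf k u + u i.castSucc * ∑ k, dZ k)))
      (u i.castSucc) := by
  have hne : (Fin.last (n + 1)) ≠ i.castSucc := fun h => (Fin.castSucc_lt_last i).ne' h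
  have hsum : HasDerivAt (fun a => ∑ k, Zf k (Function.update u i.castSucc a)) (∑ k, dZ k) (u i.castSucc) :=
    HasDerivAt.fun_sum (u := Finset.univ) (A := fun k a => Zf k (Function.update u i.castSucc a))
      (A' := fun k => dZ k) fun k _ => hZ k
  have hid : HasDerivAt (fun a => Function.update u i.castSucc a i.castSucc) 1 (u i.castSucc) := by
    have : (fun a => Function.update u i.castSucc a i.castSucc) = id := funext fun a => Function.update_self ..
    rw [this]
    exact hasDerivAt_id _
  have h := ((hZ i.succ).sub (hid.mul hsum)).const_mul ((u (Fin.last (n + 1))) ^ n)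
  simp only [Function.update_eq_self] at h
  refine h.congr_of_eventuallyEq (Filter.Eventually.of_forall fun a => ?_)
  simp only [Function.update_of_ne hne, Pi.sub_apply, Pi.mul_apply]

/-- Product rule for the `y`-slice of the adjugate component `Ỹ_y = y^(n+1) Σ_k Z_k`. [folklore] -/
theorem hasDerivAt_adjY {n : ℕ} (u : Fin (n + 2) → ℝ) (Zf : Fin (n + 2) → (Fin (n + 2) → ℝ) → ℝ)
    (dZ : Fin (n + 2) → ℝ)
    (hZ : ∀ k, HasDerivAt (fun a => Zf k (Function.update u (Fin.last (n + 1)) a)) (dZ k) (u (Fin.last (n + 1)))) :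
    HasDerivAt (fun a => (Function.update u (Fin.last (n + 1)) a (Fin.last (n + 1))) ^ (n + 1) *
        ∑ k, Zf k (Function.update u (Fin.last (n + 1)) a))
      (((n + 1 : ℕ) : ℝ) * (u (Fin.last (n + 1))) ^ n * ∑ k, Zf k u +
        (u (Fin.last (n + 1))) ^ (n + 1) * ∑ k, dZ k) (u (Fin.last (n + 1))) := by
  have hsum : HasDerivAt (fun a => ∑ k, Zf k (Function.update u (Fin.last (n + 1)) a)) (∑ k, dZ k)
      (u (Fin.last (n + 1))) :=
    HasDerivAt.fun_sum (u := Finset.univ) (A := fun k a => Zf k (Function.update u (Fin.last (n + 1)) a))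
      (A' := fun k => dZ k) fun k _ => hZ k
  have hpow : HasDerivAt (fun a => (Function.update u (Fin.last (n + 1)) a (Fin.last (n + 1))) ^ (n + 1))
      (((n + 1 : ℕ) : ℝ) * (u (Fin.last (n + 1))) ^ n) (u (Fin.last (n + 1))) := by
    have h1 : (fun a => (Function.update u (Fin.last (n + 1)) a (Fin.last (n + 1))) ^ (n + 1)) =
        fun a : ℝ => a ^ (n + 1) := funext fun a => by rw [Function.update_self]
    rw [h1]
    simpa using hasDerivAt_pow (n + 1) (u (Fin.last (n + 1)))
  have h := hpow.mul hsum
  simp only [Function.update_eq_self] at h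
  exact h

/-- **Chain rule through the blow-up chart, `θ_i`-slice.** `T u = (1 − y θ₀, 1 − y θ₁, …)` with
`θ_j = u_j` (`j ≤ n`), `y = u_{n+1}`, `θ₀ = 1 − Σθ_j`; along `θ_i` the chart moves with velocity
`y e₀ − y e_{i+1}`. [folklore] -/
theorem hasDerivAt_comp_chart_theta {n : ℕ} (T : (Fin (n + 2) → ℝ) → (Fin (n + 2) → ℝ))
    (hT0 : ∀ u, T u 0 = 1 - u (Fin.last (n + 1)) * (1 - ∑ j : Fin (n + 1), u j.castSucc))
    (hTs : ∀ u (j : Fin (n + 1)), T u j.succ = 1 - u (Fin.last (n + 1)) * u j.castSucc)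
    (u : Fin (n + 2) → ℝ) (Y : (Fin (n + 2) → ℝ) → ℝ) (L : (Fin (n + 2) → ℝ) →L[ℝ] ℝ)
    (hY : HasFDerivAt Y L (T u)) (i : Fin (n + 1)) :
    HasDerivAt (fun a => Y (T (Function.update u i.castSucc a)))
      (u (Fin.last (n + 1)) * L (Pi.single 0 1) - u (Fin.last (n + 1)) * L (Pi.single i.succ 1))
      (u i.castSucc) := by
  have hne : (Fin.last (n + 1)) ≠ i.castSucc := fun h => (Fin.castSucc_lt_last i).ne' h
  set y := u (Fin.last (n + 1)) with hy
  set V : Fin (n + 2) → ℝ := y • (Pi.single 0 1 : Fin (n + 2) → ℝ) - y • Pi.single i.succ 1 with hV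
  have hV0 : V 0 = y := by
    simp [hV, (Fin.succ_ne_zero i).symm]
  have hVi : V i.succ = -y := by
    simp [hV, Fin.succ_ne_zero]
  have hVj : ∀ j : Fin (n + 1), j ≠ i → V j.succ = 0 := by
    intro j hj
    simp [hV, Fin.succ_ne_zero, (Fin.succ_injective (n + 1)).ne hj]
  -- the chart along the slice, componentwise
  have hT : HasDerivAt (fun a => T (Function.update u i.castSucc a)) V (u i.castSucc) := by
    rw [hasDerivAt_pi]
    intro k
    refine Fin.cases ?_ (fun j => ?_) k
    · -- component 0
      have hs : ∀ a, ∑ j : Fin (n + 1), Function.update u i.castSucc a j.castSucc =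
          (∑ j : Fin (n + 1), u j.castSucc) - u i.castSucc + a := by
        intro a
        rw [← Finset.sum_erase_add _ _ (Finset.mem_univ i), ← Finset.sum_erase_add _ _ (Finset.mem_univ i),
          Function.update_self, add_sub_cancel_right]
        congr 1
        refine Finset.sum_congr rfl fun j hj => ?_
        rw [Function.update_of_ne]
        exact fun h => (Finset.ne_of_mem_erase hj) (Fin.castSucc_injective _ h)
      have h0 : (fun a => T (Function.update u i.castSucc a) 0) =
          fun a => 1 - y * (1 - ((∑ j : Fin (n + 1), u j.castSucc) - u i.castSucc + a)) := by
        funext a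
        rw [hT0, Function.update_of_ne hne, hs a]
      rw [h0, hV0]
      have := (((hasDerivAt_id (u i.castSucc)).const_add
        ((∑ j : Fin (n + 1), u j.castSucc) - u i.castSucc)).const_sub 1).const_mul y |>.const_sub 1
      refine (this.congr_of_eventuallyEq (Filter.Eventually.of_forall fun a => rfl)).congr_deriv ?_
      ring
    · -- component j.succ
      by_cases hj : j = i
      · subst hj
        have h1 : (fun a => T (Function.update u j.castSucc a) j.succ) = fun a => 1 - y * a := by
          funext a; rw [hTs, Function.update_of_ne hne, Function.update_self]
        rw [h1, hVi]
        refine (((hasDerivAt_id (u j.castSucc)).const_mul y).const_sub 1).congr_deriv ?_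
        simp
      · have h1 : (fun a => T (Function.update u i.castSucc a) j.succ) = fun _ => 1 - y * u j.castSucc := by
          funext a
          rw [hTs, Function.update_of_ne hne, Function.update_of_ne]
          exact fun h => hj (Fin.castSucc_injective _ h)
        rw [h1, hVj j hj]
        exact hasDerivAt_const (u i.castSucc) (1 - y * u j.castSucc)
  have hTu : T (Function.update u i.castSucc (u i.castSucc)) = T u := by rw [Function.update_eq_self]
  have hY' : HasFDerivAt Y L (T (Function.update u i.castSucc (u i.castSucc))) := by rwa [hTu]
  refine (hY'.comp_hasDerivAt (u i.castSucc) hT).congr_deriv ?_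
  rw [hV, map_sub, map_smul, map_smul, smul_eq_mul, smul_eq_mul]

/-- **Chain rule through the blow-up chart, `y`-slice**: along `y` the chart moves with velocity
`−(θ₀ e₀ + Σ_j θ_j e_{j+1})`. [folklore] -/
theorem hasDerivAt_comp_chart_y {n : ℕ} (T : (Fin (n + 2) → ℝ) → (Fin (n + 2) → ℝ))
    (hT0 : ∀ u, T u 0 = 1 - u (Fin.last (n + 1)) * (1 - ∑ j : Fin (n + 1), u j.castSucc))
    (hTs : ∀ u (j : Fin (n + 1)), T u j.succ = 1 - u (Fin.last (n + 1)) * u j.castSucc)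
    (u : Fin (n + 2) → ℝ) (Y : (Fin (n + 2) → ℝ) → ℝ) (L : (Fin (n + 2) → ℝ) →L[ℝ] ℝ)
    (hY : HasFDerivAt Y L (T u)) :
    HasDerivAt (fun a => Y (T (Function.update u (Fin.last (n + 1)) a)))
      (-((1 - ∑ i : Fin (n + 1), u i.castSucc) * L (Pi.single 0 1) +
        ∑ i : Fin (n + 1), u i.castSucc * L (Pi.single i.succ 1))) (u (Fin.last (n + 1))) := by
  have hne : ∀ j : Fin (n + 1), j.castSucc ≠ Fin.last (n + 1) := fun j h => (Fin.castSucc_lt_last j).ne h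
  set θ0 := 1 - ∑ i : Fin (n + 1), u i.castSucc with hθ0
  set V : Fin (n + 2) → ℝ :=
    -(θ0 • (Pi.single 0 1 : Fin (n + 2) → ℝ) + ∑ i : Fin (n + 1), u i.castSucc • Pi.single i.succ 1) with hV
  have hV0 : V 0 = -θ0 := by
    simp [hV, Finset.sum_apply, Fin.succ_ne_zero]
  have hVj : ∀ j : Fin (n + 1), V j.succ = -u j.castSucc := by
    intro j
    simp [hV, Pi.single_apply, Finset.sum_apply, Fin.succ_ne_zero]
  have hT : HasDerivAt (fun a => T (Function.update u (Fin.last (n + 1)) a)) V (u (Fin.last (n + 1))) := by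
    rw [hasDerivAt_pi]
    intro k
    refine Fin.cases ?_ (fun j => ?_) k
    · have hs : ∀ a, ∑ j : Fin (n + 1), Function.update u (Fin.last (n + 1)) a j.castSucc =
          ∑ j : Fin (n + 1), u j.castSucc := fun a =>
        Finset.sum_congr rfl fun j _ => by rw [Function.update_of_ne (hne j)]
      have h0 : (fun a => T (Function.update u (Fin.last (n + 1)) a) 0) = fun a => 1 - a * θ0 := by
        funext a
        rw [hT0, Function.update_self, hs a]
      rw [h0, hV0]
      refine (((hasDerivAt_id (u (Fin.last (n + 1)))).mul_const θ0).const_sub 1).congr_deriv ?_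
      simp
    · have h1 : (fun a => T (Function.update u (Fin.last (n + 1)) a) j.succ) = fun a => 1 - a * u j.castSucc := by
        funext a; rw [hTs, Function.update_self, Function.update_of_ne (hne j)]
      rw [h1, hVj]
      refine (((hasDerivAt_id (u (Fin.last (n + 1)))).mul_const (u j.castSucc)).const_sub 1).congr_deriv ?_
      simp
  have hTu : T (Function.update u (Fin.last (n + 1)) (u (Fin.last (n + 1)))) = T u := by
    rw [Function.update_eq_self]
  have hY' : HasFDerivAt Y L (T (Function.update u (Fin.last (n + 1)) (u (Fin.last (n + 1))))) := by rwa [hTu]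
  refine (hY'.comp_hasDerivAt (u (Fin.last (n + 1))) hT).congr_deriv ?_
  rw [hV, map_neg, map_add, map_smul, map_sum, smul_eq_mul]
  congr 2
  exact Finset.sum_congr rfl fun i _ => by rw [map_smul, smul_eq_mul]

end DivPullback

/-- **Divergence-free pull-back (pointwise form).** If the `θ_i`- and `y`-slices of `Z_k = Y_k∘T` have the
chain-rule derivatives `y·D0 k − y·Dm k i` and `−(θ₀ D0 k + Σ_i θ_i Dm k i)` at `u`, and `div Y (T u) =
D0 0 + Σ_i Dm (i+1) i = 0`, then any values `dθ i`, `dy` of the coordinate derivatives of the adjugate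
components `Ỹ_{θ_i} = y^n (Z_{i+1} − θ_i Σ Z)`, `Ỹ_y = y^(n+1) Σ Z` at `u` satisfy `Σ_i dθ i + dy = 0`. [folklore] -/
theorem div_adj_eq_zero : ∀ {n : ℕ} (u : Fin (n + 2) → ℝ) (Zf : Fin (n + 2) → (Fin (n + 2) → ℝ) → ℝ)
    (D0 : Fin (n + 2) → ℝ) (Dm : Fin (n + 2) → Fin (n + 1) → ℝ) (dθ : Fin (n + 1) → ℝ) (dy : ℝ),
    (∀ k i, HasDerivAt (fun a => Zf k (Function.update u i.castSucc a))
      (u (Fin.last (n + 1)) * D0 k - u (Fin.last (n + 1)) * Dm k i) (u i.castSucc)) →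
    (∀ k, HasDerivAt (fun a => Zf k (Function.update u (Fin.last (n + 1)) a))
      (-((1 - ∑ i : Fin (n + 1), u i.castSucc) * D0 k + ∑ i : Fin (n + 1), u i.castSucc * Dm k i))
      (u (Fin.last (n + 1)))) →
    D0 0 + ∑ i, Dm i.succ i = 0 →
    (∀ i, HasDerivAt (fun a => (Function.update u i.castSucc a (Fin.last (n + 1))) ^ n *
        (Zf i.succ (Function.update u i.castSucc a) -
          (Function.update u i.castSucc a i.castSucc) * ∑ k, Zf k (Function.update u i.castSucc a)))
        (dθ i) (u i.castSucc)) →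
    HasDerivAt (fun a => (Function.update u (Fin.last (n + 1)) a (Fin.last (n + 1))) ^ (n + 1) *
        ∑ k, Zf k (Function.update u (Fin.last (n + 1)) a)) dy (u (Fin.last (n + 1))) →
    ∑ i, dθ i + dy = 0 := by
  intro n u Zf D0 Dm dθ dy hθ hy hdiv hdθ hdy
  set y := u (Fin.last (n + 1)) with hy'
  set θ : Fin (n + 1) → ℝ := fun i => u i.castSucc with hθ'
  have e1 : ∀ i, dθ i = y ^ n * ((y * D0 i.succ - y * Dm i.succ i) - (∑ k, Zf k u) -
      θ i * ∑ k, (y * D0 k - y * Dm k i)) := by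
    intro i
    have h := DivPullback.hasDerivAt_adjTheta u Zf i (fun k => y * D0 k - y * Dm k i) (fun k => hθ k i)
    have := (hdθ i).unique h
    rw [this]
    ring
  have e2 : dy = (n + 1) * y ^ n * (∑ k, Zf k u) +
      y ^ (n + 1) * ∑ k, (-((1 - ∑ i, θ i) * D0 k + ∑ i, θ i * Dm k i)) := by
    have h := DivPullback.hasDerivAt_adjY u Zf _ hy
    have := hdy.unique h
    rw [this]
    push_cast
    ring
  rw [Finset.sum_congr rfl fun i _ => e1 i, e2]
  exact DivPullback.piola_alg n θ y (fun k => Zf k u) D0 Dm hdiv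

/-- **The `v`-extension** `Λ = a(vζ) d(vζ) ∧ Ξ̃` of a closed flux form: with `V_i = a(vζ)·ζ·Ỹ_i` on the
base and `V_v = a(vζ)·v·(∇ζ·Ỹ)`, one has `Σ_i ∂_iV_i − ∂_vV_v = a(vζ)ζ·div Ỹ = 0` — pointwise, with all
derivatives along coordinate lines. [folklore] -/
theorem vext_eq_zero : ∀ {N : ℕ} (u : Fin N → ℝ) (v : ℝ) (ζf : (Fin N → ℝ) → ℝ) (Yf : Fin N → (Fin N → ℝ) → ℝ)
    (af : ℝ → ℝ) (A' : ℝ) (zi dY : Fin N → ℝ) (dVu : Fin N → ℝ) (dVv : ℝ),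
    (∀ i, HasDerivAt (fun b => ζf (Function.update u i b)) (zi i) (u i)) →
    (∀ i, HasDerivAt (fun b => Yf i (Function.update u i b)) (dY i) (u i)) →
    HasDerivAt af A' (v * ζf u) → ∑ i, dY i = 0 →
    (∀ i, HasDerivAt (fun b => af (v * ζf (Function.update u i b)) * ζf (Function.update u i b) *
      Yf i (Function.update u i b)) (dVu i) (u i)) →
    HasDerivAt (fun b => af (b * ζf u) * b * ∑ i, zi i * Yf i u) dVv v →
    ∑ i, dVu i - dVv = 0 := by
  intro N u v ζf Yf af A' zi dY dVu dVv hζ hY ha hdiv hVu hVv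
  -- the derivatives, computed
  have e1 : ∀ i, dVu i = A' * (v * zi i) * ζf u * Yf i u + af (v * ζf u) * zi i * Yf i u +
      af (v * ζf u) * ζf u * dY i := by
    intro i
    have hin : HasDerivAt (fun b => v * ζf (Function.update u i b)) (v * zi i) (u i) := (hζ i).const_mul v
    have ha' : HasDerivAt af A' (v * ζf (Function.update u i (u i))) := by rwa [Function.update_eq_self]
    have hcomp := ha'.comp (u i) hin
    have h := (hcomp.mul (hζ i)).mul (hY i)
    simp only [Function.update_eq_self, Function.comp_def, Pi.mul_apply] at h
    have := (hVu i).unique h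
    rw [this]
    ring
  have e2 : dVv = (A' * ζf u * v + af (v * ζf u)) * ∑ i, zi i * Yf i u := by
    have hin : HasDerivAt (fun b : ℝ => b * ζf u) (1 * ζf u) v := (hasDerivAt_id v).mul_const _
    have hcomp := ha.comp v hin
    have h := ((hcomp.mul (hasDerivAt_id v)).mul_const (∑ i, zi i * Yf i u))
    simp only [Function.comp_def, id] at h
    have := hVv.unique h
    rw [this]
    ring
  rw [Finset.sum_congr rfl fun i _ => e1 i, e2, Finset.sum_add_distrib, Finset.sum_add_distrib]
  have h3 : ∑ i, A' * (v * zi i) * ζf u * Yf i u = A' * v * ζf u * ∑ i, zi i * Yf i u := by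
    rw [Finset.mul_sum]; exact Finset.sum_congr rfl fun i _ => by ring
  have h4 : ∑ i, af (v * ζf u) * zi i * Yf i u = af (v * ζf u) * ∑ i, zi i * Yf i u := by
    rw [Finset.mul_sum]; exact Finset.sum_congr rfl fun i _ => by ring
  have h5 : ∑ i, af (v * ζf u) * ζf u * dY i = af (v * ζf u) * ζf u * ∑ i, dY i := by
    rw [Finset.mul_sum]
  rw [h3, h4, h5, hdiv]
  ring

end Summit.KontsevichZagierPeriods.TerasomaMultiplication.MultiplicationAccessible
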